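import Summits.HodgeConjecture.HodgeConjecture.Theorems.UeP4OfEngines
import Summits.HodgeConjecture.HodgeConjecture.Theorems.SiegelUniversalFamilyFlatFramedFibresPiece
import Summits.HodgeConjecture.HodgeConjecture.Theorems.UeP4bHodgeFrameMarkingsPiece
import Summits.HodgeConjecture.HodgeConjecture.Theorems.UeP4bFlatLevelReadingsPiece
import HarnessLib

/-!
# U-e P4 ON A SMOOTH CLOPEN PIECE: the local holomorphic period map from (F) and the flat-Gram engine on the piece

Sub-problem `HodgeConjecture` (cell HC_CM, (U)-lane node U-e P4, G-AN1 «P4 local on the base / P4 on a smooth clopen piece»;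
P4 lead B-p03 (g14)).  PIECE EDITION of ★ `UeP4OfEngines.ue_P4_of_engines` (`Theorems/UeP4OfEngines.lean`): the base `M ⊗ ℂ` is
replaced by a smooth quasi-projective piece `ι : S′ ⟶ M ⊗ ℂ` (an open immersion, `S′` smooth of relative dimension `d` — the
tree proves `M ⊗ ℂ` smooth but not equidimensional, so the global relative dimension `d` of the original statement is only
available piecewise), the universal family by its pullback `familyPullback.snd (univFamilyℂ 𝓜) ι`, the base point by a complex
point `t₀` of `S′` with `ι(t₀)` the classifying point of `P₀`, holomorphy is read in the algebraic charts of `S′(ℂ)`, and triples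
are classified at `ι(x)`.  Hypotheses: the printed fact (F) `lan2013_siegelFineModuliScheme` and the piece ENGINE (N3-core)
(binder `hN3`, the lead's socket text `UHead.Ue_N3core_flatPolarisationGram_piece` with `IsFlatIntegralFrame` spelled out;
discharged in `Theorems/UeP4N3corePiece.lean`).  Everything else is the global proof verbatim over the piece hands: (B1a-piece)
`UnivFamilyFlatFramedFibresPiece.ue_P4b1a_flatFrameUniformisations_piece_holds`, ★ (G₀) `intGram_eq_typeForm_of_symplecticLift`,
(B1b-piece) `UeP4bHodgeFrameMarkings.ueP4b1b_hodgeFrameMarkings_piece` (B-p05 (g14)), (B2-piece)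
`UnivFamilyLevelReadings.levelSection_eq_r_of_flatFrame_piece` (B-p16 (g12)), ★ (B4)
`SiegelAdelicMarking.exists_pairingRead_forall_of_intGram_eq_typeForm`, ★ P4c `isAdmissibleAt_of_levelReading` and ★
`UeP4OfEngines.exists_marking_r_eq_of_eq`.  Main result: `ue_P4_piece_of_engines` (conclusion = the lead's socket text
`UHead.Ue_P4_piece` verbatim).  HC_CM is proved only modulo the 7 printed citations until rung 0 closes; this helper changes no count.

## References
* [LangeBirkenhake1992] H. Lange, Ch. Birkenhake, *Complex Abelian Varieties*, Springer 1992, Ch. 8 §8.1–8.2 (Prop. 8.1.1).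
* [VoisinHodgeI2002] C. Voisin, *Hodge Theory and Complex Algebraic Geometry I*, CUP 2002, §9.2.1, §10.2.1 Thm. 10.3.
* [VoisinHodgeII2003] C. Voisin, *Hodge Theory and Complex Algebraic Geometry II*, CUP 2003, §3.1.2.
* [MumfordFogartyKirwan1994] D. Mumford, J. Fogarty, F. Kirwan, *Geometric Invariant Theory*, 3rd ed., Ch. 6 §2 Prop. 6.10
  (p. 121), Ch. 7 §3 Thm. 7.9 (p. 139), Appendix to Ch. 7 §A (p. 235).
* [Milne2005ShimuraVarieties] J. S. Milne, *Introduction to Shimura Varieties*, §6 Thm. 6.11 pp. 74–75, §12 (63) p. 116.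
* [Lan2013PELCompactifications] K.-W. Lan, *Arithmetic compactifications of PEL-type Shimura varieties*, §1.4.1.
* [Hartshorne1977] R. Hartshorne, *Algebraic Geometry*, Springer 1977, III Prop. 9.3 and Prop. 10.1 (base change of smooth proper families).
-/

set_option autoImplicit false
set_option linter.dupNamespace false

noncomputable section

open CategoryTheory CategoryTheory.Limits AlgebraicGeometry Matrix Topology
open Literature.AlgebraicGeometry
open Literature.AlgebraicGeometry.Motives (SchemeOver ComplexPoints AlgPoints specOver AbelianVariety CartierDivisor fiberOver)
open Literature.AlgebraicGeometry.HodgeTheory (ofRatClass)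
open Literature.AlgebraicGeometry.AbelianSchemes (PolarizedAbelianSchemeWithLevel AbelianSchemeOver)
open Literature.AlgebraicGeometry.ModuliOfAbelianVarieties
open Literature.AlgebraicGeometry.ModuliOfAbelianVarieties.SiegelModuli
open Literature.Geometry.Kaehler (ComplexTorus)
open Literature.NumberTheory.Transcendental (IsAnalytification)
open Literature.NumberTheory.Automorphic (siegelUpperHalfSpace)
open Literature.NumberTheory.Adeles
open Literature.AlgebraicTopology.SingularHomology

namespace Summit.HodgeConjecture.HodgeConjecture.Theorems

namespace UeP4OfEnginesPiece

/-- **U-e P4 ON A PIECE FROM (F) AND THE PIECE (N3-core) ENGINE — `ue_P4_piece_of_engines (hF) (hN3)`.**  The conclusion is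
the lead's socket text `UHead.Ue_P4_piece` verbatim; `hN3` is the (N3-core)-piece socket text with `IsFlatIntegralFrame` spelled
out.  Proof: (F) ⇒ quasi-projectivity inputs (★ `W1.smooth_qproj_of_F`); (B1a-piece) flat-framed uniformised fibres over a chart
ball `W ∋ x₀ = t₀` of `S′(ℂ)` with base marking `m₀` and lift `Λ₀`; `hN3` ⇒ constant Gram; ★ (G₀) Gram `E_δ` at `x₀`; (B1b-piece)
markings by `[J(π x), r]` with flat Gram, `π` continuous and chart-holomorphic on `S′(ℂ)`, `π t₀ = Z₀`, level reading at `x₀`;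
(B2-piece) level readings at every `x`; ★ (B4) pairing readings through `r`; ★ P4c admissibility at `(π x, r)`.
[cite: LangeBirkenhake1992, Ch. 8 §8.1–8.2 (Prop. 8.1.1)] [cite: VoisinHodgeI2002, §10.2.1 Thm. 10.3]
[cite: MumfordFogartyKirwan1994, Appendix to Ch. 7 §A (p. 235)] [cite: Milne2005ShimuraVarieties, §6 Thm. 6.11 pp. 74–75 and §12 (63) p. 116] -/
theorem ue_P4_piece_of_engines (hF : lan2013_siegelFineModuliScheme)
    (hN3 :
      ∀ (g N : ℕ) (δ : Fin g → ℕ) (_hg : 0 < g) (_hδ : IsPolarizationType δ) (_hN : 3 ≤ N)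
        (𝓜 : SiegelFineModuliScheme g N δ) (_hMq : HodgeTheory.IsQuasiProjectiveOver 𝓜.M)
        (_hXq : HodgeTheory.IsQuasiProjectiveOver (W1.univTotal 𝓜))
        {S' : SchemeOver ℂ} (ι : S' ⟶ (Motives.baseChange ℚ ℂ).obj 𝓜.M) [IsOpenImmersion ι.left]
        (_hSq : HodgeTheory.IsQuasiProjectiveOver S') (d : ℕ) [SmoothOfRelativeDimension d S'.hom],
        haveI : IsLocallyNoetherian (specOver ℚ ℂ).left :=
          inferInstanceAs (IsLocallyNoetherian (Spec (CommRingCat.of ℂ)))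
        ∀ (W : Set (ComplexPoints S')) (_hW : IsPathConnected W)
          (hU : HodgeTheory.IsCohomologicallyLocallyTrivialOn (Motives.familyPullback.snd (W1.univFamilyℂ 𝓜) ι) W)
          (P' : W → PolarizedAbelianSchemeWithLevel g N δ (specOver ℚ ℂ).left)
          (G : ∀ x : W, (P' x).A.X.left ⟶ 𝓜.univ.A.X.left) (Ĝ : ∀ x : W, (P' x).D.hat.X.left ⟶ 𝓜.univ.D.hat.X.left)
          (hbc : ∀ x : W, (P' x).IsBaseChangeVia 𝓜.univ
            ((AlgPoints.baseChangeEquiv (algebraMap ℚ ℂ) 𝓜.M).symm (AlgPoints.map (L := ℂ) ι x.1)).left (G x) (Ĝ x))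
          (γ : ∀ x : W, Fin g ⊕ Fin g →
            singularCohomology ℚ ℚ (ComplexPoints (fiberOver (Motives.familyPullback.snd (W1.univFamilyℂ 𝓜) ι) x.1)) 1)
          (Φ : ∀ _x : W, (Fin g ⊕ Fin g → ℝ) ≃L[ℝ] (Fin g → ℂ))
          (φ : ∀ x : W, C(ComplexTorus (Φ x), ((P' x).A.fibre (𝟙 (Spec (CommRingCat.of ℂ)))).toAbelianVariety.Points ℂ))
          (hφ : ∀ x : W, IsAnalytification (Fin g → ℂ)
            ((P' x).A.fibre (𝟙 (Spec (CommRingCat.of ℂ)))).toAbelianVariety.X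
            ((P' x).A.fibre (𝟙 (Spec (CommRingCat.of ℂ)))).toAbelianVariety.dim (φ x))
          (Θ : ∀ x : W, CartierDivisor ((P' x).A.fibre (𝟙 (Spec (CommRingCat.of ℂ)))).toAbelianVariety.X.left),
          ((∀ x : W, LinearIndependent ℂ fun a => HodgeTheory.ofRatClass _ 1 (γ x a)) ∧
            (∀ (x : W) (c : HodgeTheory.complexBetti (fiberOver (Motives.familyPullback.snd (W1.univFamilyℂ 𝓜) ι) x.1) 1),
                HodgeTheory.IsIntegralClass c ↔
                  c ∈ Submodule.span ℤ (Set.range fun a => HodgeTheory.ofRatClass _ 1 (γ x a))) ∧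
            ∀ (x x' : W) (p : Path.Homotopic.Quotient x x') (a : Fin g ⊕ Fin g),
              HodgeTheory.transportFun (Motives.familyPullback.snd (W1.univFamilyℂ 𝓜) ι) 1 hU p (HodgeTheory.ofRatClass _ 1 (γ x a)) =
                HodgeTheory.ofRatClass _ 1 (γ x' a)) →
          (∀ (x : W) (s t : ComplexTorus (Φ x)), φ x (s + t) = φ x s * φ x t) →
          (∀ (x : W) (a : Fin g ⊕ Fin g),
            singularCohomology.map ℚ ℚ
                (((Motives.AlgPoints.homeomorphOfIso (L := ℂ)
                    (W1.fibreAVIso (P' x) ≪≫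
                      (W1.fiberUnivIsoOfIsBaseChangeVia 𝓜 (AlgPoints.map (L := ℂ) ι x.1) (P' x) (G x) (Ĝ x) (hbc x)).symm ≪≫
                      (Motives.fiberOverFamilyPullbackIso (W1.univFamilyℂ 𝓜) ι x.1).symm) :
                    ((P' x).A.fibre (𝟙 (Spec (CommRingCat.of ℂ)))).toAbelianVariety.Points ℂ ≃ₜ
                      ComplexPoints (fiberOver (Motives.familyPullback.snd (W1.univFamilyℂ 𝓜) ι) x.1)) :
                  C(((P' x).A.fibre (𝟙 (Spec (CommRingCat.of ℂ)))).toAbelianVariety.Points ℂ,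
                    ComplexPoints (fiberOver (Motives.familyPullback.snd (W1.univFamilyℂ 𝓜) ι) x.1))).comp (φ x)) 1 (γ x a) =
              HodgeTheory.latticeClass (Φ x) a) →
          (∀ x : W, (Θ x).IsAmple) →
          (∀ x : W, (P' x).A.IsLambdaOfAt (𝟙 (Spec (CommRingCat.of ℂ))) (P' x).D (P' x).pol.lam (Θ x)) →
          ∀ (x₀ x : W) (p₀ : ComplexTorus.AHData (Φ x₀)) (p : ComplexTorus.AHData (Φ x)),
            ComplexTorus.AHData.toPic p₀ =
                ComplexTorus.picClass (HodgeTheory.cartierDivisorLineBundle (hφ x₀) (Θ x₀)) →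
            ComplexTorus.AHData.toPic p =
                ComplexTorus.picClass (HodgeTheory.cartierDivisorLineBundle (hφ x) (Θ x)) →
            ComplexTorus.intGram (Φ x) p.form = ComplexTorus.intGram (Φ x₀) p₀.form) :
    ∀ (g N : ℕ) (δ : Fin g → ℕ) (_hg : 0 < g) (hδ : IsPolarizationType δ) (_hN : 3 ≤ N)
      (𝓜 : SiegelFineModuliScheme g N δ) (r : gspFinAdelic δ)
      {S' : SchemeOver ℂ} (ι : S' ⟶ (Motives.baseChange ℚ ℂ).obj 𝓜.M) [IsOpenImmersion ι.left]
      (_hSq : HodgeTheory.IsQuasiProjectiveOver S')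
      (d : ℕ) [SmoothOfRelativeDimension d S'.hom],
      haveI : IsLocallyNoetherian (specOver ℚ ℂ).left :=
        inferInstanceAs (IsLocallyNoetherian (Spec (CommRingCat.of ℂ)))
      haveI : Smooth S'.hom := SmoothOfRelativeDimension.smooth d _
      haveI : LocallyOfFiniteType S'.hom := inferInstance
      r ∈ principalLevelSubgroup δ 1 →
      ∀ (Z₀ : Matrix (Fin g) (Fin g) ℂ) (hZ₀ : Z₀ ∈ siegelUpperHalfSpace g)
        (P₀ : PolarizedAbelianSchemeWithLevel g N δ (specOver ℚ ℂ).left), IsAdmissibleAt hδ r Z₀ hZ₀ P₀ →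
      ∀ (t₀ : ComplexPoints S'),
        AlgPoints.map (L := ℂ) ι t₀ =
          AlgPoints.baseChangeEquiv (algebraMap ℚ ℂ) 𝓜.M (𝓜.classifyingMap (specOver ℚ ℂ) P₀) →
      ∃ (W : Set (ComplexPoints S')) (π : ComplexPoints S' → Matrix (Fin g) (Fin g) ℂ),
        IsOpen W ∧ t₀ ∈ W ∧ π t₀ = Z₀ ∧ ContinuousOn π W ∧
        -- `π` is holomorphic on `W`, entrywise, read in every holomorphic algebraic chart of `S′(ℂ)`
        (∀ x ∈ W, ∀ (i j : Fin g),
          DifferentiableOn ℂ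
            ((fun y ↦ π y i j) ∘ (ComplexPoints.algebraicChart S' d x).symm)
            ((ComplexPoints.algebraicChart S' d x).target ∩ (ComplexPoints.algebraicChart S' d x).symm ⁻¹' W)) ∧
        -- `π` READS ADMISSIBILITY at `r` on `W`, at triples classified by `ι x`
        (∀ x ∈ W, ∃ hx : π x ∈ siegelUpperHalfSpace g,
          ∃ P' : PolarizedAbelianSchemeWithLevel g N δ (specOver ℚ ℂ).left,
            IsAdmissibleAt hδ r (π x) hx P' ∧
            AlgPoints.baseChangeEquiv (algebraMap ℚ ℂ) 𝓜.M (𝓜.classifyingMap (specOver ℚ ℂ) P') = AlgPoints.map (L := ℂ) ι x) := by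
  intro g N δ hg hδ hN 𝓜 r S' ι _ hSq d _ hr Z₀ hZ₀ P₀ hP₀ t₀ ht₀
  haveI : IsLocallyNoetherian (specOver ℚ ℂ).left :=
    inferInstanceAs (IsLocallyNoetherian (Spec (CommRingCat.of ℂ)))
  have hN0 : N ≠ 0 := by omega
  -- (F) ⇒ (F-c′)/(F-c″)
  obtain ⟨-, hMq, hXq⟩ := W1.smooth_qproj_of_F hF hg hδ hN 𝓜
  -- (B1a-piece): flat-framed uniformised fibres over a chart ball of `S′(ℂ)` at `t₀`, base marking at `x₀ = t₀`
  obtain ⟨W, x₀, hx₀, hWo, hWpc, hWc, hU, P', G, Ĝ, hbc, γ, Φ, φ, Θ, m₀, Λ₀, hcls, hflat, hφ, hadd, hframe, hΘ, hlam, hγ₀,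
      hΨ₀, hu₀, htower⟩ :=
    UnivFamilyFlatFramedFibresPiece.ue_P4b1a_flatFrameUniformisations_piece_holds g N δ hg hδ hN 𝓜 hMq hXq r ι hSq d hr Z₀ hZ₀
      P₀ hP₀ t₀ ht₀
  -- (N3-core-piece): the Gram is constant on `W`
  have hconst := hN3 g N δ hg hδ hN 𝓜 hMq hXq ι hSq d W hWpc hU P' G Ĝ hbc γ Φ φ hφ Θ hflat hadd hframe hΘ hlam
  -- ★ (G₀): Gram `E_δ` at `x₀` in `m₀`'s currency
  have hG0 : ∀ p : ComplexTorus.AHData m₀.Ψ,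
      ComplexTorus.AHData.toPic p =
          ComplexTorus.picClass (HodgeTheory.cartierDivisorLineBundle m₀.isAnalytification (Θ x₀)) →
        ComplexTorus.intGram m₀.Ψ p.form = typeForm δ := fun p hp ↦
    intGram_eq_typeForm_of_symplecticLift (P' x₀).pol hδ hg hN0 (P' x₀).hasType (hlam x₀) (hΘ x₀) hr hZ₀ m₀ hγ₀ Λ₀
      htower p hp
  -- (B1b-piece): Siegel-normalised Hodge-frame markings (B-p05 (g14))
  obtain ⟨π, J, mark, hγ1, hΨ, htoFun, hmf, hfg, hnorm, hcont, hhol, hπ₀, hlev⟩ :=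
    UeP4bHodgeFrameMarkings.ueP4b1b_hodgeFrameMarkings_piece g N δ hg hδ hN 𝓜 hMq hXq ι r d hr Z₀ hZ₀ W hWo hWpc x₀ hWc hU
      P' G Ĝ
      hbc γ Φ φ Θ m₀ Λ₀ hcls hflat hφ hadd hframe hΘ hlam hγ₀ hΨ₀ hu₀ htower hG0 hconst
  -- ★ (B4): ONE root system with pairing readings through `r` at every `x`
  obtain ⟨ζ, hζ, hζ_pow, hpair⟩ :=
    SiegelAdelicMarking.exists_pairingRead_forall_of_intGram_eq_typeForm (N := N) hδ hg hr mark hγ1 Θ hfg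
  refine ⟨W, π, hWo, ?_, ?_, hcont, hhol, fun x hxW ↦ ?_⟩
  · rw [← hx₀]; exact x₀.2
  · rw [← hx₀]; exact hπ₀
  -- at `x ∈ W`: transport the marking to the point `J(π x)` and read admissibility (★ P4c)
  obtain ⟨hxH, hJ⟩ := hnorm ⟨x, hxW⟩
  obtain ⟨m, hmr⟩ := UeP4OfEngines.exists_marking_r_eq_of_eq (mark ⟨x, hxW⟩) hJ
  refine ⟨hxH, P' ⟨x, hxW⟩, isAdmissibleAt_of_levelReading hδ (P' ⟨x, hxW⟩) (Θ ⟨x, hxW⟩) (hΘ _) (hlam _) (π x) hxH r m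
    ζ hζ hζ_pow ?_ ?_, hcls _⟩
  · intro M hNM hMΩ a b P Q hP hQ
    exact hpair ⟨x, hxW⟩ hNM hMΩ a b P Q (fun v hv ↦ by rw [hP v hv, hmr]) (fun w hw ↦ by rw [hQ w hw, hmr])
  · intro i
    obtain ⟨v, hv, h0⟩ := hlev i
    refine ⟨v, hv, ?_⟩
    rw [hmr]
    exact UnivFamilyLevelReadings.levelSection_eq_r_of_flatFrame_piece hN 𝓜 r ι hSq d W hWpc hU P' G Ĝ hbc J mark hγ1 γ
      hflat.2.2 hmf i v x₀ h0 ⟨x, hxW⟩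

end UeP4OfEnginesPiece

end Summit.HodgeConjecture.HodgeConjecture.Theorems

end
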